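import Summits.ABC.ABC.Theorems.TwistAmplificationSharpModerateLawTwistMinimalPointwiseHall
import Summits.ABC.ABC.Theorems.TwistAmplificationSharpModerateLawTwistedFreyFacts
import Summits.ABC.ABC.Theorems.TwistAmplificationSharpModerateLawCornerHallToHallRegime

/-!
# Crux `TwistAmplification.SharpModerateLaw` (stmt-ABC-1975): the pointwise summand of the twist-orbit inversion
is the summit

Lead `prover-line-stmt-ABC-1975-c6-0`, skeleton v5 (line `unit-plane-conic-two-torsion`, twist-orbit inversion of the
core), calibration `pointwiseSzpiroCusp_iff_abc : PointwiseSzpiroCusp ↔ ABC` of the residual stub `stub_pointwiseSzpiro`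
(file `…TwistMinimalPointwise.lean`): the pointwise summand of the inversion `CoreLaw ⟸ CoreLawTM ∧ PointwiseSzpiroCusp`
IS the summit.

* (←) `pointwiseSzpiroCusp_of_abc` — Bombieri–Gubler, *Heights in Diophantine Geometry* (2006), Theorem 12.5.12:
  abc (strict form, `ABC_iff`) ⟹ abc (`≤`-form) ⟹ strong Hall (`Literature.NumberTheory.DiophantineGeometry.strongHall_of_abcLe`,
  (a) ⟹ (b)) ⟹ `PointwiseSzpiroCusp` (`pointwiseSzpiroCusp_of_strongHall` of `…TwistMinimalPointwiseHall.lean`, the printed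
  proof of (b) ⟹ (c) run on tower-free cusp pairs with the conductor proxy `N5cusp`; no elliptic curve is needed).
* (→) `abc_of_pointwiseSzpiroCusp` — through the Frey pair of an abc triple (`CuspDispersion.twistedFreyPair_facts` at
  `d = 1`: tower-free, `1728 ∣ c₄³ − c₆²`, `N* ≤ 2·rad(abc)`, `c₄³ ≥ 1728·c⁶`) and `UnitPlane.n5cusp_le_nstar`, taking
  sixth roots (`le_rpow_sixth_of_pow_six_le`); this is the crux-strategist's kernel-checked calibration
  (`Cruxes/SharpModerateLaw/PointwiseSzpiroCalibration.lean`, planner-cstrat-stmt-ABC-1975-p1-0), retargeted to the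
  Defs-file `PointwiseSzpiroCusp`.
-/

noncomputable section

-- the mandated summit namespace `Summit.ABC.ABC` (summit = problem) trips the duplicate-namespace linter
set_option linter.dupNamespace false

namespace Summit.ABC.ABC.Theorems.SharpModerateLaw

open Literature.NumberTheory.DiophantineGeometry (rad IsABCTriple strongHall_of_abcLe)
open CuspDispersion (twistedFreyPair_facts)
open UnitPlane (n5cusp_le_nstar)

/-! ## 1. The summit ⟹ pointwise Szpiro in cusp coordinates -/

/-- **`ABC → PointwiseSzpiroCusp`**: the summit (strict form, `ABC_iff`) gives the `≤`-form of abc, hence the strong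
Hall conjecture (Bombieri–Gubler 12.5.12 (a) ⟹ (b), `strongHall_of_abcLe`), hence the claim
(`pointwiseSzpiroCusp_of_strongHall`). -/
theorem pointwiseSzpiroCusp_of_abc (h : _root_.ABC) : PointwiseSzpiroCusp := by
  refine pointwiseSzpiroCusp_of_strongHall (strongHall_of_abcLe fun ε hε ↦ ?_)
  obtain ⟨C, -, hC⟩ := (ABC_iff.mp h) ε hε
  exact ⟨C, fun a b c ht ↦ (hC a b c ht).le⟩

/-! ## 2. Pointwise Szpiro in cusp coordinates ⟹ the summit (through the Frey pairs) -/

/-- Sixth-root extraction: `c⁶ ≤ K·r^{6(1+ε)}` with `K, r ≥ 0`, `c ≥ 0` gives `c ≤ K^{1/6}·r^{1+ε}`. -/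
theorem le_rpow_sixth_of_pow_six_le {c r K ε : ℝ} (hc : 0 ≤ c) (hr : 0 ≤ r) (hK : 0 ≤ K)
    (h : c ^ (6 : ℕ) ≤ K * r ^ (6 * (1 + ε))) : c ≤ K ^ (1 / 6 : ℝ) * r ^ (1 + ε) := by
  have h6 : (0 : ℝ) ≤ 1 / 6 := by norm_num
  have hl : (c ^ (6 : ℕ)) ^ (1 / 6 : ℝ) = c := by
    rw [← Real.rpow_natCast c 6, ← Real.rpow_mul hc]; norm_num
  have hrr : (r ^ (6 * (1 + ε))) ^ (1 / 6 : ℝ) = r ^ (1 + ε) := by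
    rw [← Real.rpow_mul hr]; congr 1; ring
  calc c = (c ^ (6 : ℕ)) ^ (1 / 6 : ℝ) := hl.symm
    _ ≤ (K * r ^ (6 * (1 + ε))) ^ (1 / 6 : ℝ) := Real.rpow_le_rpow (by positivity) h h6
    _ = K ^ (1 / 6 : ℝ) * r ^ (1 + ε) := by
        rw [Real.mul_rpow hK (Real.rpow_nonneg hr _), hrr]

/-- **`PointwiseSzpiroCusp → ABC`.**  Given `ε > 0` use the pointwise hypothesis at `η := 6ε` on the Frey pair
`x = (c₄, c₆)` of an abc triple `a + b = c` (`a ≠ b`; the triple `(1,1,2)` is handled by the constant):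
`1728·c⁶ ≤ c₄³ ≤ M⁺(x) ≤ C·N5cusp(x)^{6+6ε} ≤ C·(2·rad(abc))^{6+6ε}`, and take sixth roots (crux-strategist's
calibration, `Cruxes/SharpModerateLaw/PointwiseSzpiroCalibration.lean`). -/
theorem abc_of_pointwiseSzpiroCusp (h : PointwiseSzpiroCusp) : _root_.ABC := by
  rw [ABC_iff]
  intro ε hε
  obtain ⟨C, hC⟩ := h (6 * ε) (by positivity)
  set C₀ : ℝ := max C 1 with hC₀
  have hC₀1 : 1 ≤ C₀ := le_max_right _ _
  have hC₀0 : 0 ≤ C₀ := by linarith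
  -- the constant
  set K : ℝ := C₀ * (2 : ℝ) ^ (6 * (1 + ε)) / 1728 with hK
  have hK0 : 0 ≤ K := by rw [hK]; positivity
  have hK6 : 0 ≤ K ^ (1 / 6 : ℝ) := Real.rpow_nonneg hK0 _
  refine ⟨K ^ (1 / 6 : ℝ) + 3, by linarith, ?_⟩
  intro a b c ht
  obtain ⟨ha, hb, habc, hcop⟩ := ht
  have hrad1 : (1 : ℝ) ≤ (rad a b c : ℝ) := by
    have : rad a b c ≠ 0 := by
      rw [Literature.NumberTheory.DiophantineGeometry.rad_def]; exact UniqueFactorizationMonoid.radical_ne_zero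
    exact_mod_cast Nat.one_le_iff_ne_zero.mpr this
  have hrpow1 : (1 : ℝ) ≤ (rad a b c : ℝ) ^ (1 + ε) := Real.one_le_rpow hrad1 (by linarith)
  by_cases hab : a = b
  · -- `a = b` coprime forces `a = b = 1`, `c = 2`
    subst hab
    have ha1 : a = 1 := by simpa [Nat.coprime_self] using hcop
    subst ha1
    have hc2 : c = 2 := by omega
    subst hc2
    have : (2 : ℝ) < (K ^ (1 / 6 : ℝ) + 3) * 1 := by linarith
    calc ((2 : ℕ) : ℝ) = 2 := by norm_num
      _ < (K ^ (1 / 6 : ℝ) + 3) * 1 := this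
      _ ≤ (K ^ (1 / 6 : ℝ) + 3) * ((rad 1 1 2 : ℕ) : ℝ) ^ (1 + ε) :=
          mul_le_mul_of_nonneg_left hrpow1 (by positivity)
  · -- the Frey pair at `d = 1`
    set x : ℤ × ℤ := (((1 : ℕ) : ℤ) ^ 2 * (freyPair a b).1, ((1 : ℕ) : ℤ) ^ 3 * (freyPair a b).2) with hx
    obtain ⟨h1, h2, h3, h4, hTF, hN, -, -, hpos, hcube, hlow, -⟩ :=
      twistedFreyPair_facts a b 1 ha hb hab hcop (Or.inl rfl) (Nat.coprime_one_left _) x hx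
    have key := hC x h1 h2 h3 h4 hTF
    -- lower bound `1728 c⁶ ≤ M⁺(x)`
    have hM : (1728 : ℝ) * (c : ℝ) ^ (6 : ℕ) ≤ (Mcusp x : ℝ) := by
      have hM1 : x.1.natAbs ^ 3 ≤ Mcusp x := le_max_right _ _
      have hM2 : ((x.1.natAbs ^ 3 : ℕ) : ℤ) = x.1 ^ 3 := by
        push_cast; simp [abs_of_nonneg hpos.le]
      have hM3 : (1728 : ℤ) * (c : ℤ) ^ 6 ≤ x.1 ^ 3 := by
        rw [hcube, ← habc]; push_cast; simp only [mul_one]; linarith [hlow]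
      have hM4 : (1728 : ℤ) * (c : ℤ) ^ 6 ≤ ((Mcusp x : ℕ) : ℤ) := by
        calc (1728 : ℤ) * (c : ℤ) ^ 6 ≤ x.1 ^ 3 := hM3
          _ = ((x.1.natAbs ^ 3 : ℕ) : ℤ) := hM2.symm
          _ ≤ ((Mcusp x : ℕ) : ℤ) := by exact_mod_cast hM1
      exact_mod_cast hM4
    -- upper bound `N5cusp(x) ≤ 2 rad`
    have hN5 : (N5cusp x : ℝ) ≤ 2 * (rad a b c : ℝ) := by
      have : N5cusp x ≤ 2 * rad a b (a + b) * 1 ^ 2 := (n5cusp_le_nstar x).trans hN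
      rw [habc] at this
      exact_mod_cast (by simpa using this)
    have hN50 : (0 : ℝ) ≤ (N5cusp x : ℝ) := Nat.cast_nonneg _
    have hexp : (0 : ℝ) ≤ 6 + 6 * ε := by linarith
    have hup : (Mcusp x : ℝ) ≤ C₀ * (2 * (rad a b c : ℝ)) ^ (6 + 6 * ε) := by
      calc (Mcusp x : ℝ) ≤ C * (N5cusp x : ℝ) ^ (6 + 6 * ε) := key
        _ ≤ C₀ * (N5cusp x : ℝ) ^ (6 + 6 * ε) :=
            mul_le_mul_of_nonneg_right (le_max_left _ _) (Real.rpow_nonneg hN50 _)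
        _ ≤ C₀ * (2 * (rad a b c : ℝ)) ^ (6 + 6 * ε) :=
            mul_le_mul_of_nonneg_left (Real.rpow_le_rpow hN50 hN5 hexp) hC₀0
    -- combine: `c⁶ ≤ K · rad^{6(1+ε)}`
    have hr0 : (0 : ℝ) ≤ (rad a b c : ℝ) := by linarith
    have hsplit : (2 * (rad a b c : ℝ)) ^ (6 + 6 * ε) =
        (2 : ℝ) ^ (6 * (1 + ε)) * (rad a b c : ℝ) ^ (6 * (1 + ε)) := by
      rw [Real.mul_rpow (by norm_num) hr0]; congr 1 <;> ring_nf
    have hc6 : (c : ℝ) ^ (6 : ℕ) ≤ K * (rad a b c : ℝ) ^ (6 * (1 + ε)) := by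
      have := hM.trans hup
      rw [hsplit] at this
      rw [hK]
      have h1728 : (0 : ℝ) < 1728 := by norm_num
      calc (c : ℝ) ^ (6 : ℕ) = (1728 * (c : ℝ) ^ (6 : ℕ)) / 1728 := by field_simp
        _ ≤ (C₀ * ((2 : ℝ) ^ (6 * (1 + ε)) * (rad a b c : ℝ) ^ (6 * (1 + ε)))) / 1728 :=
            div_le_div_of_nonneg_right this h1728.le
        _ = C₀ * (2 : ℝ) ^ (6 * (1 + ε)) / 1728 * (rad a b c : ℝ) ^ (6 * (1 + ε)) := by ring
    have hcle : (c : ℝ) ≤ K ^ (1 / 6 : ℝ) * (rad a b c : ℝ) ^ (1 + ε) :=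
      le_rpow_sixth_of_pow_six_le (Nat.cast_nonneg _) hr0 hK0 hc6
    calc (c : ℝ) ≤ K ^ (1 / 6 : ℝ) * (rad a b c : ℝ) ^ (1 + ε) := hcle
      _ < (K ^ (1 / 6 : ℝ) + 3) * (rad a b c : ℝ) ^ (1 + ε) := by
          have : (0 : ℝ) < (rad a b c : ℝ) ^ (1 + ε) := by linarith
          nlinarith

/-! ## 3. The calibration -/

/-- **Calibration of the residual stub `stub_pointwiseSzpiro`** (skeleton v5, line `unit-plane-conic-two-torsion`): the
pointwise summand `PointwiseSzpiroCusp` of the twist-orbit inversion of the core IS the summit — (→) through the Frey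
pairs of abc triples, (←) through Bombieri–Gubler 12.5.12, abc ⟹ strong Hall ⟹ generalized Szpiro in cusp
coordinates with the proxy `N5cusp`. -/
theorem pointwiseSzpiroCusp_iff_abc : PointwiseSzpiroCusp ↔ _root_.ABC :=
  ⟨abc_of_pointwiseSzpiroCusp, pointwiseSzpiroCusp_of_abc⟩

end Summit.ABC.ABC.Theorems.SharpModerateLaw

end
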